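import Summits.Parity.GeneralizedHardyLittlewood.Theorems.PrimeLevelFamEdgeMomentsBeyondDiagonalLayersKloostermanProduct
import Summits.Parity.GeneralizedHardyLittlewood.Theorems.PrimeLevelFamEdgeMomentsBeyondDiagonalLayersKloostermanScale
import Summits.Parity.GeneralizedHardyLittlewood.Theorems.PrimeLevelFamEdgeMomentsBeyondDiagonalLayersCoprimality
import HarnessLib

/-!
# Route `PrimeLevelFamEdge`, crux K_A `MomentsBeyondDiagonal` (stmt-Parity-20007), line «petersson_layers» v4:
# the NORMAL FORM of one layer term's Kloosterman sum — sharp/flat split, gcd extraction, balanced regrouping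

One algebraic statement assembling `…LayersKloostermanScale` (gcd extraction), `…LayersKloostermanProduct` (unit swap) and
`…LayersCoprimality`: write the four variables of a Hecke-split layer term as `mᵢ = sᵢ·fᵢ`, `nᵢ = tᵢ·hᵢ` with the «flat» parts
`fᵢ, hᵢ` prime to the modulus `c` (the «sharp» parts `sᵢ, tᵢ` carry the primes of `c`; e.g. `sᵢ = (mᵢ, c^∞)` — any such split
will do), and let `g = ((m₁n₁, m₂n₂), c)`.  Then `g ∣ s₁t₁`, `g ∣ s₂t₂`, and

  `φ(c/g) · S(m₁n₁, m₂n₂; c) = φ(c) · S((s₁t₁/g)·(f₁f₂), (s₂t₂/g)·(h₁h₂); c/g)`,   `(((s₁t₁/g)f₁f₂, (s₂t₂/g)h₁h₂), c/g) = 1`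

(`kloostermanSum_term_normal_form`, `coprime_term_normal_form`): for FIXED sharp data the Kloosterman value is a dilated Kloosterman
sum at modulus `c/g` in the BALANCED flat products `u♭ = f₁f₂` (mollifier side), `v♭ = h₁h₂` (AFE side), satisfying Pascadi's summation
condition — exactly the kernel-on-support shape of `…LayersBlockPascadiBound.norm_sum_four_le_of_pascadi` (`σ₁ = s₁t₁/g`, `σ₂ = s₂t₂/g`,
modulus `c/g`; for `c = qr` in the band, `q ∤ g` and `c/g = q·(r/g)`).
Proof only (def-free helper toward `stub_farP` / `stub_band`); no layer is bounded here; K_A NOT proved; nothing about Landau–Siegel zeros.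
-/

noncomputable section

open Finset
open Literature.NumberTheory.LFunctions

namespace Summit.Parity.GeneralizedHardyLittlewood.Theorems.MomentsBeyondDiagonal.Layers

/-- `g = ((a·f, b·h), c)` with `f, h` prime to `c` divides the sharp parts: `g ∣ a` (and symmetrically `g ∣ b`). [folklore] -/
theorem gcd_gcd_dvd_sharp {a f b' c : ℕ} (hf : Nat.Coprime f c) :
    Nat.gcd (Nat.gcd (a * f) b') c ∣ a := by
  have h1 : Nat.gcd (Nat.gcd (a * f) b') c ∣ a * f := (Nat.gcd_dvd_left _ _).trans (Nat.gcd_dvd_left _ _)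
  have h2 : Nat.gcd (Nat.gcd (a * f) b') c ∣ c := Nat.gcd_dvd_right _ _
  have hcop : Nat.Coprime (Nat.gcd (Nat.gcd (a * f) b') c) f :=
    Nat.Coprime.coprime_dvd_left h2 hf.symm
  exact hcop.dvd_of_dvd_mul_right h1

/-- **Pascadi's summation condition for the normal form**: with `g = ((s₁t₁·f₁h₁, s₂t₂·f₂h₂), c)` and all flats prime to `c`,
`(((s₁t₁/g)·(f₁f₂), (s₂t₂/g)·(h₁h₂)), c/g) = 1`. [folklore] -/
theorem coprime_term_normal_form {s₁ t₁ s₂ t₂ f₁ h₁ f₂ h₂ c : ℕ} (hc : c ≠ 0)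
    (hf₁ : Nat.Coprime f₁ c) (hh₁ : Nat.Coprime h₁ c) (hf₂ : Nat.Coprime f₂ c) (hh₂ : Nat.Coprime h₂ c) :
    Nat.Coprime
      (Nat.gcd (s₁ * t₁ / Nat.gcd (Nat.gcd (s₁ * t₁ * (f₁ * h₁)) (s₂ * t₂ * (f₂ * h₂))) c * (f₁ * f₂))
        (s₂ * t₂ / Nat.gcd (Nat.gcd (s₁ * t₁ * (f₁ * h₁)) (s₂ * t₂ * (f₂ * h₂))) c * (h₁ * h₂)))
      (c / Nat.gcd (Nat.gcd (s₁ * t₁ * (f₁ * h₁)) (s₂ * t₂ * (f₂ * h₂))) c) := by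
  set a := s₁ * t₁ * (f₁ * h₁) with ha
  set b := s₂ * t₂ * (f₂ * h₂) with hb
  set g := Nat.gcd (Nat.gcd a b) c with hg
  have hgc : g ∣ c := Nat.gcd_dvd_right _ _
  have hc' : c / g ∣ c := Nat.div_dvd_of_dvd hgc
  -- flats are prime to `c/g`
  have hF : Nat.Coprime (f₁ * f₂) (c / g) := (Nat.Coprime.mul_left hf₁ hf₂).coprime_dvd_right hc'
  have hH : Nat.Coprime (h₁ * h₂) (c / g) := (Nat.Coprime.mul_left hh₁ hh₂).coprime_dvd_right hc'
  -- the residual sharp parts `σ₁ = s₁t₁/g`, `σ₂ = s₂t₂/g` have `((σ₁, σ₂), c/g) = 1`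
  have hgs₁ : g ∣ s₁ * t₁ := by
    rw [hg, ha]; exact gcd_gcd_dvd_sharp (Nat.Coprime.mul_left hf₁ hh₁)
  have hgs₂ : g ∣ s₂ * t₂ := by
    have : Nat.gcd (Nat.gcd a b) c = Nat.gcd (Nat.gcd b a) c := by rw [Nat.gcd_comm a b]
    rw [hg, this, hb]; exact gcd_gcd_dvd_sharp (Nat.Coprime.mul_left hf₂ hh₂)
  have hres := coprime_gcd_div_gcd (a := a) (b := b) hc
  rw [← hg] at hres
  have ha' : a / g = (f₁ * h₁) * (s₁ * t₁ / g) := by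
    rw [ha, mul_comm (s₁ * t₁) (f₁ * h₁), Nat.mul_div_assoc _ hgs₁]
  have hb' : b / g = (f₂ * h₂) * (s₂ * t₂ / g) := by
    rw [hb, mul_comm (s₂ * t₂) (f₂ * h₂), Nat.mul_div_assoc _ hgs₂]
  have h1 : s₁ * t₁ / g ∣ a / g := by rw [ha']; exact dvd_mul_left _ _
  have h2 : s₂ * t₂ / g ∣ b / g := by rw [hb']; exact dvd_mul_left _ _
  have hσ : Nat.Coprime (Nat.gcd (s₁ * t₁ / g) (s₂ * t₂ / g)) (c / g) :=
    Nat.Coprime.coprime_dvd_left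
      ((Nat.gcd_dvd_gcd_of_dvd_left _ h1).trans (Nat.gcd_dvd_gcd_of_dvd_right _ h2)) hres
  exact coprime_gcd_mul_mul_of_coprime hF hH hσ

/-- **The normal form of one term's Kloosterman sum.** With flats `fᵢ, hᵢ` prime to `c`, `a = s₁t₁·f₁h₁`, `b = s₂t₂·f₂h₂`,
`g = ((a,b),c)`: `φ(c/g)·S(a, b; c) = φ(c)·S((s₁t₁/g)·(f₁f₂), (s₂t₂/g)·(h₁h₂); c/g)` (gcd extraction, then the flats `h₁`, `f₂`
swapped across as units mod `c/g`). [folklore] -/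
theorem kloostermanSum_term_normal_form {c : ℕ} [NeZero c] {s₁ t₁ s₂ t₂ f₁ h₁ f₂ h₂ : ℕ}
    (hf₁ : Nat.Coprime f₁ c) (hh₁ : Nat.Coprime h₁ c) (hf₂ : Nat.Coprime f₂ c) (hh₂ : Nat.Coprime h₂ c)
    [NeZero (c / Nat.gcd (Nat.gcd (s₁ * t₁ * (f₁ * h₁)) (s₂ * t₂ * (f₂ * h₂))) c)] :
    ((c / Nat.gcd (Nat.gcd (s₁ * t₁ * (f₁ * h₁)) (s₂ * t₂ * (f₂ * h₂))) c).totient : ℂ) *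
        kloostermanSum c ((s₁ * t₁ * (f₁ * h₁) : ℕ) : ZMod c) ((s₂ * t₂ * (f₂ * h₂) : ℕ) : ZMod c) =
      (c.totient : ℂ) *
        kloostermanSum (c / Nat.gcd (Nat.gcd (s₁ * t₁ * (f₁ * h₁)) (s₂ * t₂ * (f₂ * h₂))) c)
          ((s₁ * t₁ / Nat.gcd (Nat.gcd (s₁ * t₁ * (f₁ * h₁)) (s₂ * t₂ * (f₂ * h₂))) c * (f₁ * f₂) : ℕ) :
            ZMod (c / Nat.gcd (Nat.gcd (s₁ * t₁ * (f₁ * h₁)) (s₂ * t₂ * (f₂ * h₂))) c))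
          ((s₂ * t₂ / Nat.gcd (Nat.gcd (s₁ * t₁ * (f₁ * h₁)) (s₂ * t₂ * (f₂ * h₂))) c * (h₁ * h₂) : ℕ) :
            ZMod (c / Nat.gcd (Nat.gcd (s₁ * t₁ * (f₁ * h₁)) (s₂ * t₂ * (f₂ * h₂))) c)) := by
  set a := s₁ * t₁ * (f₁ * h₁) with ha
  set b := s₂ * t₂ * (f₂ * h₂) with hb
  set g := Nat.gcd (Nat.gcd a b) c with hg
  set c' := c / g with hc'
  have hgc : g ∣ c := Nat.gcd_dvd_right _ _
  have hcg : c = g * c' := (Nat.mul_div_cancel' hgc).symm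
  have hga : g ∣ a := (Nat.gcd_dvd_left _ _).trans (Nat.gcd_dvd_left a b)
  have hgb : g ∣ b := (Nat.gcd_dvd_left _ _).trans (Nat.gcd_dvd_right a b)
  have hgs₁ : g ∣ s₁ * t₁ := by rw [hg, ha]; exact gcd_gcd_dvd_sharp (Nat.Coprime.mul_left hf₁ hh₁)
  have hgs₂ : g ∣ s₂ * t₂ := by
    have : Nat.gcd (Nat.gcd a b) c = Nat.gcd (Nat.gcd b a) c := by rw [Nat.gcd_comm a b]
    rw [hg, this, hb]; exact gcd_gcd_dvd_sharp (Nat.Coprime.mul_left hf₂ hh₂)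
  -- Step 1: gcd extraction
  have hscale := totient_mul_kloostermanSum_of_eq_mul (c := c') (c' := c) (g := g) hcg (a / g) (b / g)
  rw [Nat.mul_div_cancel' hga, Nat.mul_div_cancel' hgb] at hscale
  rw [hscale]
  congr 1
  -- Step 2: the flats `h₁`, `f₂` are units mod `c'`; swap them across
  have hc'c : c' ∣ c := Nat.div_dvd_of_dvd hgc
  have hu_h₁ : IsUnit ((h₁ : ℕ) : ZMod c') := (ZMod.isUnit_iff_coprime h₁ c').mpr (hh₁.coprime_dvd_right hc'c)
  have hu_f₂ : IsUnit ((f₂ : ℕ) : ZMod c') := (ZMod.isUnit_iff_coprime f₂ c').mpr (hf₂.coprime_dvd_right hc'c)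
  have ha' : a / g = (s₁ * t₁ / g * f₁) * h₁ := by
    rw [ha, mul_comm (s₁ * t₁) (f₁ * h₁), Nat.mul_div_assoc _ hgs₁]; ring
  have hb' : b / g = f₂ * (s₂ * t₂ / g * h₂) := by
    rw [hb, mul_comm (s₂ * t₂) (f₂ * h₂), Nat.mul_div_assoc _ hgs₂]; ring
  rw [ha', hb']
  push_cast
  rw [kloostermanSum_mul_mul_swap_of_isUnit _ _ hu_h₁ hu_f₂]
  congr 1 <;> ring

end Summit.Parity.GeneralizedHardyLittlewood.Theorems.MomentsBeyondDiagonal.Layers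

end
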